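import Literature.Geometry.Lorentzian.LeviCivita
import Literature.Geometry.Riemannian.BachTensor
import HarnessLib

/-!
# The linearised Ricci operator `DRic_g` and the Lie derivative of a field of bilinear forms

Definitions (real, with bodies; NO named fact is introduced — this file is meant to sit in the
import cone of route files and imports only `Lorentzian/LeviCivita.lean`,
`Riemannian/BachTensor.lean` (for `covDeriv₃`) and Mathlib) requested by route
`FinalStateConjecture/BeltLiouville` (definition item `defn-linearizedRicci`, "D1"): for a `C^n`
pseudo-Riemannian metric `g : PseudoRiemannianMetric I n E (TangentSpace I : M → Type _)` with its
Levi-Civita connection `∇ = g.leviCivita` (standing instance hypothesis `[g.HasLeviCivita]`,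
`LeviCivita.lean`), a vector field `X` and a field
`w : Π x, T_x M →L[ℝ] T_x M →L[ℝ] ℝ` of continuous bilinear forms on `TM` (a `(0,2)`-tensor field,
e.g. a metric perturbation `γ_{ab} = dg_{ab}/dλ|_{λ=0}`), we define, pointwise at `x : M`,

* `g.lieDerivBilin X w x` — the **Lie derivative `(𝓛_X w)_x`** of `w` along `X`, a continuous
  bilinear form on `T_x M`,
  `(𝓛_X w)(V, W) = (∇_X w)(V, W) + w(∇_V X, W) + w(V, ∇_W X)`
  (Wald 1984, (C.2.14) with `k = 0`, `l = 2`: `𝓛_v T_{ab} = v^c ∇_c T_{ab} + T_{cb} ∇_a v^c + T_{ac} ∇_b v^c`,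
  valid for the torsion-free `∇`; here `(∇_X w)(V,W) = g.covDeriv₂ w x V W (X x)`);
* `g.secondCovDeriv w x` — the **second covariant derivative `(∇²w)_x`**, the `4`-linear map
  `(∇²w)(X, Y, Z, V) = (∇_V ∇w)(X, Y, Z) = w_{XY;ZV}` (`= ∇_V ∇_Z w_{XY}` in Wald's abstract-index
  notation, `= D²_{V,Z} w (X, Y)` in Besse's), i.e. `g.covDeriv₃` (`BachTensor.lean`) of the field
  `y ↦ g.covDeriv₂ w y` (`LeviCivita.lean`); both derivative slots last, the second one last;
* `g.linearizedRicci w x` — the **linearised Ricci operator** `DRic_g(w)_x = (d/dλ) Ric(g + λw)|_{λ=0}`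
  as a bilinear form on `T_x M`, through Wald's formula (7.5.14)/(7.5.15)
  `Ṙ_{ac} = -½ g^{bd} ∇_a ∇_c γ_{bd} - ½ g^{bd} ∇_b ∇_d γ_{ac} + g^{bd} ∇_b ∇_{(c} γ_{a)d}`, i.e.
  `DRic(w)_{ab} = -½ ∇_a ∇_b (tr_g w) - ½ □_g w_{ab} + ∇^c ∇_{(a} w_{b)c}`, transcribed letter for
  letter: with `Q = ∇²w` as above,
  `DRic(w)(X, Y) = -½ tr_g[(U,U') ↦ Q(U,U',Y,X)] - ½ tr_g[(U,U') ↦ Q(X,Y,U',U)]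
                   + ½ (tr_g[(U,U') ↦ Q(X,U',Y,U)] + tr_g[(U,U') ↦ Q(Y,U',X,U)])`
  (`tr_g = g.trace x`, the metric contraction of `PseudoRiemannianMetric.lean`); the three
  slot-arrangements of `Q` entering here are `g.linRicciForm₁/₂/₃ w x`;
  `g.linearizedRicciCLM w x` is the same as a continuous bilinear form (finite dimension), so that
  `x ↦ DRic(w)_x` is again a field of the type of `w`.

## Sources

* R. M. Wald, *General Relativity*, Chicago 1984: §7.5, (7.5.7)–(7.5.15) (first variation of the
  Christoffel symbols `Ċ^c_{ab} = ½ g^{cd}(∇_a γ_{bd} + ∇_b γ_{ad} - ∇_d γ_{ab})` and of the Ricci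
  tensor, `Ṙ_{ac} = -2∇_{[a} Ċ^b{}_{b]c}`, giving (7.5.14); (7.5.15) is the same with
  `γ = g^{ab}γ_{ab}`; (7.5.23) the Lichnerowicz form in transverse-traceless gauge, not used
  here); Appendix C.2, (C.2.14) (Lie derivative of a tensor field through a derivative operator),
  (C.2.15)–(C.2.17) (`𝓛_v g` is the gauge freedom of linearised gravity), (C.2.16)
  (`𝓛_v g_{ab} = ∇_a v_b + ∇_b v_a`), (C.3.1) (Killing's equation). [Wald1984GR]
* A. L. Besse, *Einstein Manifolds* (1987), Thm. 1.174 (d) and 1.179: for a pseudo-Riemannian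
  `(M, g)` and a symmetric `h`, `r'_g h (X,Y) = ½ Σᵢ εᵢ (D²_{Xᵢ,X} h(Y,Xᵢ) + D²_{Xᵢ,Y} h(X,Xᵢ)
  - D²_{Xᵢ,Xᵢ} h(X,Y)) - ½ D d(tr_g h)(X,Y)` (`= ½ Δ_L h - δ*δh - ½ Dd(tr h)`), the same formula on
  an arbitrary (not necessarily vacuum, any signature) background. [Besse1987]
* B. O'Neill, *Semi-Riemannian geometry* (1983), Ch. 3, Def. 3.9–3.10 and Prop. 3.18 (tensor
  derivations, covariant differential), Ch. 9, Def. 9.22 and Prop. 9.25 (`X` Killing iff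
  `𝓛_X g = 0` iff `∇X` is skew). [ONeill1983]
* A. Ionescu, S. Klainerman, *On the local extension of Killing vector-fields in Ricci flat
  manifolds*, JAMS 26 (2013), arXiv:1108.3575, §2 (the deformation tensor `π = 𝓛_Z g` of a
  would-be Killing field as a solution of linearised gravity coupled to `𝓛_Z R`; the intended use
  of `DRic` by the requesting route). [IonescuKlainerman2012]

## Why (7.5.14) is the general first variation of `Ric`

Wald derives (7.5.14) in the course of linearising the VACUUM equation, but the displayed
expression for `Ṙ_{ac}` holds on every background: for the one-parameter family `g(λ) = g + λγ`,
the difference tensor `C^c{}_{ab}(λ)` of the connections satisfies (7.5.8)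
`R_{abc}{}^d(λ) = R_{abc}{}^d - 2∇_{[a} C^d{}_{b]c} + 2 C^e{}_{c[a} C^d{}_{b]e}` identically, whence,
contracting and differentiating at `λ = 0` (`C(0) = 0`), `Ṙ_{ac} = -2 ∇_{[a} Ċ^b{}_{b]c}` with no
vacuum hypothesis (the background `R_{ac}` is `λ`-independent); inserting (7.5.12) gives (7.5.14).
Besse 1987, 1.174 (d)/1.179 states the same formula for an arbitrary pseudo-Riemannian metric.
The Ricci tensor of this tree, `Ric(X,Y) = tr (v ↦ R(v,X)Y)` with
`R(X,Y)Z = ∇_X∇_Y Z - ∇_Y∇_X Z - ∇_{[X,Y]}Z` (`LeviCivita.lean`, Lee's convention), coincides with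
Wald's `R_{ac} = R_{abc}{}^b` and Besse's `r`, so no sign adjustment is needed. Dictionary of second
derivatives: Wald's `∇_p ∇_q γ_{rs}` (outer derivative `∇_p`) is `γ_{rs;qp} = Q(e_r, e_s, e_q, e_p)`,
Besse's `D²_{V,Z} h (X,Y) = (D_V D_Z h - D_{D_V Z} h)(X,Y)` is `Q(X,Y,Z,V)`. Term by term, with the
free indices `a ↔ X`, `c ↔ Y` and the contraction `g^{bd}` realised as the metric trace over the
pair `(U, U') = (e_b, e_d)`:
`g^{bd} ∇_a∇_c γ_{bd} = tr[(U,U') ↦ Q(U,U',Y,X)]`, `g^{bd} ∇_b∇_d γ_{ac} = tr[(U,U') ↦ Q(X,Y,U',U)]`,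
`g^{bd} ∇_b∇_c γ_{ad} = tr[(U,U') ↦ Q(X,U',Y,U)]` (and `a ↔ c` for the symmetrised partner).

## Design choices

* **Generality.** Any `C^n` pseudo-Riemannian metric on `TM` with `[g.HasLeviCivita]` (for smooth
  or analytic metrics on a finite-dimensional complete model space this instance is supplied by
  `HasLeviCivita.of isCovariantDerivativeOn_leviCivitaFun_holds`, `LeviCivitaProofs.lean`), any
  signature and dimension; `[FiniteDimensional ℝ E]` from `linearizedRicci` on (metric traces).
  The requester's case is a smooth Lorentzian `4`-metric (`LorentzianMetric extends
  PseudoRiemannianMetric`, so `𝓑.metric.linearizedRicci w x` typechecks) and smooth symmetric `w`.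
* **No symmetry or regularity of `w` is built in.** `DRic_g` is the linear second-order operator
  (7.5.14) on ALL fields of continuous bilinear forms; it is the derivative of `Ric` along
  `g + λw` when `w` is symmetric and `C²` (a theorem about the operator, not part of its
  definition, and not proved here). Junk values: `covDeriv₂`/`covDeriv₃` are `0` at points where
  the field differentiated is not representable (e.g. not differentiable), so `DRic(w)_x` and
  `(𝓛_X w)_x` carry the honest classical values when `w` is `C²` near `x` (resp. `w` and `X` are
  differentiable at `x`) — always the case for the smooth fields of the intended statements.
* **Types.** `lieDerivBilin` is valued in continuous bilinear forms (the type of `w x` and of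
  `g.val x`, so that `𝓛_X g` is again a perturbation: `g.linearizedRicci (g.lieDerivBilin X g.val)`
  typechecks, and `𝓛_T w = 0` expresses `T`-stationarity of `w`); `linearizedRicci w x` is a
  `LinearMap.BilinForm`, like `g.ricci x` whose derivative it is (so `g.trace x (DRic w)` is
  available for the linearised scalar curvature / Einstein operator), and `linearizedRicciCLM`
  repackages it continuously (`bilinFormCLM`, the construction of `ricciCLM`/`schoutenCLM`).
* **`𝓛_X g` and Killing fields.** `lieDerivBilin_val_apply`: given that the metric is parallel
  (the named fact `covDeriv₂_val` of `LeviCivita.lean`, hypothesis `h`, discharged as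
  `covDeriv₂_val_holds` in `LeviCivitaProofs.lean`, which is deliberately not imported),
  `(𝓛_X g)(V,W) = g(∇_V X, W) + g(V, ∇_W X)` (Wald (C.2.16)) — verbatim the body of
  `g.deformationTensor X x V W` (`KillingDefect.lean`, `deformationTensor_apply` is `rfl`; that file
  is not imported here because of its `KerrConvergence` cone, and the equality
  `g.lieDerivBilin X g.val x = g.deformationTensor X x` is `by ext; simp [lieDerivBilin_val_apply _ h]`
  for any importer of both) — whence `isKillingField_iff_lieDerivBilin_val_eq_zero`:
  `g.IsKillingField X ↔ X ∈ C^n ∧ 𝓛_X g = 0` (O'Neill 9.22/9.25; Wald (C.3.1)).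
* **Proved here (API).** Unfolding lemmas (`rfl`); `𝓛_0 w = 0`, `∇²0 = 0`, `DRic_g(0) = 0`;
  symmetry of `∇w` in its tensor slots and of `𝓛_X w` for fields of symmetric forms
  (`covDeriv₂_swap_of_symm`, `lieDerivBilin_swap_of_symm`, `lieDerivBilin_val_swap`); the
  Killing characterisation above.
* NOT here (theorems about the operator, wanted later, none needed to STATE the route's items):
  `DRic_g(𝓛_X g) = 𝓛_X Ric_g` (naturality; in particular `𝓛_X g` solves linearised vacuum on a
  Ricci-flat background — Wald (C.2.15)–(C.2.17)), symmetry of `DRic(w)` for symmetric `C²` `w`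
  (Ricci identity), linearity in `w` on differentiable fields, the linearised Bianchi identity,
  the Lichnerowicz form (7.5.23) in transverse-traceless gauge, the linearised Einstein operator
  `DG(w) = DRic(w) - ½ (tr_g DRic(w) - ⟨Ric, w⟩_g) g - ½ S w`, and the flow definition of `𝓛_X`
  (derivative along the flow of `X`) together with its agreement with the `∇`-formula.
-/

noncomputable section

open Bundle Set FiberBundle
open scoped Manifold ContDiff Topology

namespace Literature.Geometry.Lorentzian

variable {E : Type*} [NormedAddCommGroup E] [NormedSpace ℝ E] {H : Type*} [TopologicalSpace H]
  {I : ModelWithCorners ℝ E H} {M : Type*} [TopologicalSpace M] [ChartedSpace H M]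
  [IsManifold I ∞ M] {n : ℕ∞ω} {x : M}

/-! ### Bilinear forms on a tangent space as continuous bilinear maps -/

section CLM

variable [FiniteDimensional ℝ E]

/-- A bilinear form `B` on the tangent space `T_x M` (definitionally the finite-dimensional model
space `E`) as a continuous bilinear map — every bilinear form on a finite-dimensional real normed
space is continuous (`LinearMap.toContinuousLinearMap`, twice). This is the packaging used inline
by `ricciCLM` (`RicciSection.lean`) and `schoutenCLM` (`BachTensor.lean`), stated once for every
`B`. [folklore] -/
def bilinFormCLM (x : M) (B : LinearMap.BilinForm ℝ (TangentSpace I x)) :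
    TangentSpace I x →L[ℝ] TangentSpace I x →L[ℝ] ℝ :=
  haveI : FiniteDimensional ℝ (TangentSpace I x) := ‹FiniteDimensional ℝ E›
  haveI : T2Space (TangentSpace I x) := inferInstanceAs (T2Space E)
  LinearMap.toContinuousLinearMap
    ((LinearMap.toContinuousLinearMap :
        (TangentSpace I x →ₗ[ℝ] ℝ) ≃ₗ[ℝ] (TangentSpace I x →L[ℝ] ℝ)).toLinearMap ∘ₗ B)

omit [IsManifold I ∞ M] in
/-- `bilinFormCLM x B` is `B`. [folklore] -/
@[simp]
theorem bilinFormCLM_apply (B : LinearMap.BilinForm ℝ (TangentSpace I x))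
    (v w : TangentSpace I x) : bilinFormCLM x B v w = B v w :=
  rfl

omit [IsManifold I ∞ M] in
/-- `bilinFormCLM x 0 = 0`. [folklore] -/
@[simp]
theorem bilinFormCLM_zero (x : M) :
    bilinFormCLM x (0 : LinearMap.BilinForm ℝ (TangentSpace I x)) = 0 := by
  ext v w
  rfl

end CLM

namespace PseudoRiemannianMetric

variable (g : PseudoRiemannianMetric I n E (TangentSpace I : M → Type _))

/-! ### The Lie derivative of a field of bilinear forms along a vector field -/

section LieDeriv

variable [g.HasLeviCivita]

/-- **The Lie derivative `(𝓛_X w)_x` of a field `w` of continuous bilinear forms on `TM` along a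
vector field `X`**, as a continuous bilinear form on `T_x M`:
`(𝓛_X w)_x(V, W) = (∇_X w)_x(V, W) + w_x(∇_V X, W) + w_x(V, ∇_W X)`, with `∇ = g.leviCivita`
the Levi-Civita connection (`(∇_X w)(V,W) = g.covDeriv₂ w x V W (X x)`, derivative slot last;
Mathlib's argument order `g.leviCivita X x V = ∇_V X`). This is Wald 1984, (C.2.14) for a
`(0,2)`-tensor, `𝓛_v T_{ab} = v^c ∇_c T_{ab} + T_{cb} ∇_a v^c + T_{ac} ∇_b v^c`, which holds for
any torsion-free derivative operator, in particular for `∇`; for `w = g` it is the deformation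
tensor `𝓛_X g = ∇_a X_b + ∇_b X_a` ((C.2.16), `lieDerivBilin_val_apply`). Honest value when `w`
and `X` are differentiable at `x`; if `X` is not, `(∇X)_x` is the junk `0` of `leviCivitaFun`, and if
`w` is not representable at `x`, `(∇w)_x` is the junk `0` of `covDeriv₂`.
[cite: Wald1984GR, Appendix C.2, (C.2.14)] -/
def lieDerivBilin (X : Π x : M, TangentSpace I x)
    (w : Π x : M, TangentSpace I x →L[ℝ] TangentSpace I x →L[ℝ] ℝ) (x : M) :
    TangentSpace I x →L[ℝ] TangentSpace I x →L[ℝ] ℝ :=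
  letI K : E →L[ℝ] E →L[ℝ] E →L[ℝ] ℝ := g.covDeriv₂ w x
  letI wx : E →L[ℝ] E →L[ℝ] ℝ := w x
  letI A : E →L[ℝ] E := g.leviCivita X x
  letI X₀ : E := X x
  show E →L[ℝ] E →L[ℝ] ℝ from
    (ContinuousLinearMap.compL ℝ E (E →L[ℝ] ℝ) ℝ (ContinuousLinearMap.apply ℝ ℝ X₀)).comp K +
      wx.comp A + (wx.flip.comp A).flip

/-- Unfolding lemma: `(𝓛_X w)_x(V, W) = (∇_X w)(V, W) + w(∇_V X, W) + w(V, ∇_W X)`.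
Wald 1984, (C.2.14). [cite: Wald1984GR, Appendix C.2, (C.2.14)] -/
@[simp]
theorem lieDerivBilin_apply (X : Π x : M, TangentSpace I x)
    (w : Π x : M, TangentSpace I x →L[ℝ] TangentSpace I x →L[ℝ] ℝ) (V W : TangentSpace I x) :
    g.lieDerivBilin X w x V W =
      g.covDeriv₂ w x V W (X x) + w x (g.leviCivita X x V) W + w x V (g.leviCivita X x W) :=
  rfl

/-- The Lie derivative along the zero vector field vanishes: `𝓛_0 w = 0` (`∇0 = 0` and the
derivative term is evaluated at `X x = 0`). [folklore] -/
@[simp]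
theorem lieDerivBilin_zero_left (w : Π x : M, TangentSpace I x →L[ℝ] TangentSpace I x →L[ℝ] ℝ)
    (x : M) : g.lieDerivBilin (0 : Π x : M, TangentSpace I x) w x = 0 := by
  ext V W
  simp [g.leviCivita.zero]

/-- **For a field of symmetric bilinear forms, `∇w` is symmetric in its tensor slots**:
`(∇_Z w)(V, W) = (∇_Z w)(W, V)`. The classical formula `covDeriv₂Aux g w X Y Z x
= Z(w(X,Y)) - w(∇_Z X, Y) - w(X, ∇_Z Y)` (`LeviCivita.lean`) is invariant under `X ↔ Y` when every
`w_y` is symmetric, hence so is the trilinear map `g.covDeriv₂ w x` representing it on extended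
vectors (and the junk branch `0` is symmetric as well). O'Neill 1983, Ch. 3, Def. 3.10 and
Prop. 3.18. [folklore] -/
theorem covDeriv₂_swap_of_symm {w : Π x : M, TangentSpace I x →L[ℝ] TangentSpace I x →L[ℝ] ℝ}
    (hw : ∀ (y : M) (V W : TangentSpace I y), w y V W = w y W V) (x : M)
    (V W Z : TangentSpace I x) :
    g.covDeriv₂ w x V W Z = g.covDeriv₂ w x W V Z := by
  have haux : ∀ X Y Z' : Π x : M, TangentSpace I x,
      g.covDeriv₂Aux w X Y Z' x = g.covDeriv₂Aux w Y X Z' x := by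
    intro X Y Z'
    have h1 : (fun y ↦ w y (X y) (Y y)) = fun y ↦ w y (Y y) (X y) := funext fun y ↦ hw y _ _
    unfold covDeriv₂Aux
    rw [h1, hw x (g.leviCivita X x (Z' x)) (Y x), hw x (X x) (g.leviCivita Y x (Z' x))]
    ring
  unfold covDeriv₂
  split_ifs with hex
  · rw [hex.choose_spec V W Z, hex.choose_spec W V Z, haux]
  · rfl

variable {g} in
/-- **The Lie derivative of a field of symmetric bilinear forms is symmetric**:
`(𝓛_X w)(V, W) = (𝓛_X w)(W, V)` (symmetric perturbations stay symmetric under `𝓛_X`).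
Wald 1984, (C.2.14). [folklore] -/
theorem lieDerivBilin_swap_of_symm
    {w : Π x : M, TangentSpace I x →L[ℝ] TangentSpace I x →L[ℝ] ℝ}
    (hw : ∀ (y : M) (V W : TangentSpace I y), w y V W = w y W V)
    (X : Π x : M, TangentSpace I x) (x : M) (V W : TangentSpace I x) :
    g.lieDerivBilin X w x V W = g.lieDerivBilin X w x W V := by
  rw [lieDerivBilin_apply, lieDerivBilin_apply, g.covDeriv₂_swap_of_symm hw x V W,
    hw x (g.leviCivita X x V) W, hw x V (g.leviCivita X x W)]
  ring

/-- **`𝓛_X g` is symmetric**: `(𝓛_X g)(V, W) = (𝓛_X g)(W, V)` (the metric is symmetric).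
Wald 1984, (C.2.16). [cite: Wald1984GR, Appendix C.2, (C.2.16)] -/
theorem lieDerivBilin_val_swap (X : Π x : M, TangentSpace I x) (x : M)
    (V W : TangentSpace I x) :
    g.lieDerivBilin X g.val x V W = g.lieDerivBilin X g.val x W V :=
  lieDerivBilin_swap_of_symm g.symm X x V W

end LieDeriv

/-! ### `𝓛_X g` is the deformation tensor; Killing fields -/

section Killing

variable [Fact (1 ≤ n)] [FiniteDimensional ℝ E] [CompleteSpace E] [g.HasLeviCivita]

/-- **`(𝓛_X g)(V, W) = g(∇_V X, W) + g(V, ∇_W X)`**, i.e. `𝓛_X g_{ab} = ∇_a X_b + ∇_b X_a`, given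
that the metric is parallel (`∇g = 0`: the named fact `covDeriv₂_val` of `LeviCivita.lean`,
hypothesis `h`, discharged as `covDeriv₂_val_holds` in `LeviCivitaProofs.lean`). The right-hand
side is verbatim `g.deformationTensor X x V W` (`KillingDefect.lean`, `deformationTensor_apply`).
Wald 1984, (C.2.16); O'Neill 1983, Ch. 9, proof of Prop. 9.25. [cite: Wald1984GR, Appendix C.2, (C.2.16)] -/
theorem lieDerivBilin_val_apply (h : g.covDeriv₂_val) (X : Π x : M, TangentSpace I x)
    (V W : TangentSpace I x) :
    g.lieDerivBilin X g.val x V W =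
      g.val x (g.leviCivita X x V) W + g.val x V (g.leviCivita X x W) := by
  rw [lieDerivBilin_apply, h x]
  simp

/-- **Killing iff `𝓛_X g = 0`.** A vector field is a Killing field of `g` (`IsKillingField`:
`C^n` and `∇X` is `g`-skew, `LeviCivita.lean`) iff it is `C^n` and the Lie derivative of the metric
along it vanishes identically (given `∇g = 0`, hypothesis `h : g.covDeriv₂_val`). O'Neill 1983,
Ch. 9, Def. 9.22 and Prop. 9.25; Wald 1984, (C.2.16)–(C.3.1).
[cite: ONeill1983, Ch. 9, Def. 9.22 and Prop. 9.25] -/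
theorem isKillingField_iff_lieDerivBilin_val_eq_zero (h : g.covDeriv₂_val)
    (X : Π x : M, TangentSpace I x) :
    g.IsKillingField X ↔ CMDiff n (T% X) ∧ ∀ x : M, g.lieDerivBilin X g.val x = 0 := by
  refine and_congr_right fun _ ↦ forall_congr' fun x ↦ ?_
  constructor
  · intro hK
    ext V W
    rw [g.lieDerivBilin_val_apply h]
    simpa using hK V W
  · intro h0 V W
    have := congrArg (fun B : TangentSpace I x →L[ℝ] TangentSpace I x →L[ℝ] ℝ ↦ B V W) h0
    simpa [g.lieDerivBilin_val_apply h] using this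

/-- The Lie derivative of the metric along a Killing field vanishes. O'Neill 1983, Ch. 9,
Prop. 9.25. [cite: ONeill1983, Ch. 9, Prop. 9.25] -/
theorem IsKillingField.lieDerivBilin_val_eq_zero (h : g.covDeriv₂_val)
    {X : Π x : M, TangentSpace I x} (hX : g.IsKillingField X) (x : M) :
    g.lieDerivBilin X g.val x = 0 :=
  ((g.isKillingField_iff_lieDerivBilin_val_eq_zero h X).mp hX).2 x

end Killing

/-! ### The second covariant derivative of a field of bilinear forms -/

section SecondCovDeriv

variable [g.HasLeviCivita]

/-- **The second covariant derivative `(∇²w)_x`** of a field `w` of continuous bilinear forms on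
`TM`, the `4`-linear map with
`secondCovDeriv g w x X Y Z V = (∇_V ∇w)(X, Y, Z) = w_{XY;ZV}` — in Wald's abstract-index notation
`∇_V ∇_Z w_{XY}` (outer derivative `∇_V`), in Besse's `D²_{V,Z} w (X,Y) = (D_V D_Z w - D_{D_V Z} w)(X,Y)`:
the covariant derivative `g.covDeriv₃` (`BachTensor.lean`) of the field of trilinear forms
`y ↦ (∇w)_y = g.covDeriv₂ w y` (`LeviCivita.lean`); both derivative slots last, the second
derivative in the last slot (the convention of `schoutenCovDeriv₂ = ∇²P` in `BachTensor.lean`).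
O'Neill 1983, Ch. 3, Def. 3.10 and Prop. 3.18; Wald 1984, §7.5 (the second derivatives
`∇_a∇_b γ_{cd}` entering (7.5.14)). [cite: ONeill1983, Ch. 3, Def. 3.10 and Prop. 3.18] -/
def secondCovDeriv (w : Π x : M, TangentSpace I x →L[ℝ] TangentSpace I x →L[ℝ] ℝ) (x : M) :
    TangentSpace I x →ₗ[ℝ] TangentSpace I x →ₗ[ℝ] TangentSpace I x →ₗ[ℝ]
      TangentSpace I x →ₗ[ℝ] ℝ :=
  g.covDeriv₃ (fun y ↦ g.covDeriv₂ w y) x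

/-- Unfolding of `∇²w`. [folklore] -/
theorem secondCovDeriv_def (w : Π x : M, TangentSpace I x →L[ℝ] TangentSpace I x →L[ℝ] ℝ)
    (x : M) : g.secondCovDeriv w x = g.covDeriv₃ (fun y ↦ g.covDeriv₂ w y) x :=
  rfl

/-- The classical formula for the covariant derivative of the zero field of bilinear forms
vanishes identically (copy, for general `n`, of the computation of `covDeriv₂_zero` in
`InitialData.lean`, which lives outside this file's import cone). [folklore] -/
private theorem covDeriv₂Aux_zero_aux (X Y Z : Π x : M, TangentSpace I x) (x : M) :
    g.covDeriv₂Aux (fun _ ↦ 0) X Y Z x = 0 := by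
  simp [covDeriv₂Aux, mvfderiv_const]

/-- **`∇0 = 0`** for fields of bilinear forms, any regularity `n` (the public `covDeriv₂_zero` of
`InitialData.lean` is the case `n = ∞`, outside this file's import cone). [folklore] -/
private theorem covDeriv₂_zero_aux (x : M) :
    g.covDeriv₂ (fun _ ↦ 0) x = 0 := by
  have h : ∃ K : TangentSpace I x →L[ℝ] TangentSpace I x →L[ℝ] TangentSpace I x →L[ℝ] ℝ,
      ∀ X₀ Y₀ Z₀ : TangentSpace I x,
        K X₀ Y₀ Z₀ = g.covDeriv₂Aux (fun _ ↦ 0) (extend E X₀) (extend E Y₀) (extend E Z₀) x :=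
    ⟨0, fun _ _ _ ↦ by simp [covDeriv₂Aux_zero_aux]⟩
  have h' : g.covDeriv₂ (fun _ ↦ 0) x = h.choose := by
    unfold covDeriv₂
    rw [dif_pos h]
  ext X₀ Y₀ Z₀
  rw [h', h.choose_spec X₀ Y₀ Z₀]
  simp [covDeriv₂Aux_zero_aux]

/-- **`∇²0 = 0`**: the second covariant derivative of the zero field of bilinear forms vanishes.
[folklore] -/
@[simp]
theorem secondCovDeriv_zero (x : M) :
    g.secondCovDeriv (0 : Π x : M, TangentSpace I x →L[ℝ] TangentSpace I x →L[ℝ] ℝ) x = 0 := by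
  have h0 : (fun y : M ↦ g.covDeriv₂
      (0 : Π x : M, TangentSpace I x →L[ℝ] TangentSpace I x →L[ℝ] ℝ) y) = fun _ ↦ 0 := by
    funext y
    exact g.covDeriv₂_zero_aux y
  rw [secondCovDeriv_def, h0, covDeriv₃_zero]

end SecondCovDeriv

/-! ### The linearised Ricci operator -/

section LinearizedRicci

variable [g.HasLeviCivita]

/-- **First slot-arrangement of `∇²w`** (the Hessian-of-the-trace term of (7.5.14)):
`linRicciForm₁ g w x X Y` is the bilinear form `(U, U') ↦ (∇²w)(U, U', Y, X) = ∇_X ∇_Y w(U, U')`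
on `T_x M`, whose metric trace is `g^{bd} ∇_a ∇_c γ_{bd}` (`a ↔ X`, `c ↔ Y`) — for `C²` fields
equal to `∇_X ∇_Y (tr_g w)`, since contraction commutes with `∇` (`∇g = 0`). Bilinear in
`(X, Y)` and valued in bilinear forms. Wald 1984, (7.5.14), first term. [cite: Wald1984GR, §7.5, (7.5.14)] -/
def linRicciForm₁ (w : Π x : M, TangentSpace I x →L[ℝ] TangentSpace I x →L[ℝ] ℝ) (x : M) :
    TangentSpace I x →ₗ[ℝ] TangentSpace I x →ₗ[ℝ] LinearMap.BilinForm ℝ (TangentSpace I x) :=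
  LinearMap.mk₂ ℝ
    (fun X Y ↦ LinearMap.mk₂ ℝ (fun U U' ↦ g.secondCovDeriv w x U U' Y X)
      (fun U₁ U₂ U' ↦ by simp only [map_add, LinearMap.add_apply])
      (fun c U U' ↦ by simp only [map_smul, LinearMap.smul_apply, smul_eq_mul])
      (fun U U'₁ U'₂ ↦ by simp only [map_add, LinearMap.add_apply])
      (fun c U U' ↦ by simp only [map_smul, LinearMap.smul_apply, smul_eq_mul]))
    (fun X₁ X₂ Y ↦ LinearMap.ext₂ fun U U' ↦ by
      simp only [LinearMap.mk₂_apply, LinearMap.add_apply, map_add])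
    (fun c X Y ↦ LinearMap.ext₂ fun U U' ↦ by
      simp only [LinearMap.mk₂_apply, LinearMap.smul_apply, map_smul, smul_eq_mul])
    (fun X Y₁ Y₂ ↦ LinearMap.ext₂ fun U U' ↦ by
      simp only [LinearMap.mk₂_apply, LinearMap.add_apply, map_add])
    (fun c X Y ↦ LinearMap.ext₂ fun U U' ↦ by
      simp only [LinearMap.mk₂_apply, LinearMap.smul_apply, map_smul, smul_eq_mul])

/-- **Second slot-arrangement of `∇²w`** (the wave-operator term of (7.5.14)):
`linRicciForm₂ g w x X Y` is the bilinear form `(U, U') ↦ (∇²w)(X, Y, U', U) = ∇_U ∇_{U'} w(X, Y)`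
on `T_x M`, whose metric trace is `g^{bd} ∇_b ∇_d γ_{ac} = (□_g w)(X, Y)`, the rough (connection)
d'Alembertian of `w`. Wald 1984, (7.5.14), second term. [cite: Wald1984GR, §7.5, (7.5.14)] -/
def linRicciForm₂ (w : Π x : M, TangentSpace I x →L[ℝ] TangentSpace I x →L[ℝ] ℝ) (x : M) :
    TangentSpace I x →ₗ[ℝ] TangentSpace I x →ₗ[ℝ] LinearMap.BilinForm ℝ (TangentSpace I x) :=
  LinearMap.mk₂ ℝ
    (fun X Y ↦ LinearMap.mk₂ ℝ (fun U U' ↦ g.secondCovDeriv w x X Y U' U)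
      (fun U₁ U₂ U' ↦ by simp only [map_add])
      (fun c U U' ↦ by simp only [map_smul, smul_eq_mul])
      (fun U U'₁ U'₂ ↦ by simp only [map_add, LinearMap.add_apply])
      (fun c U U' ↦ by simp only [map_smul, LinearMap.smul_apply, smul_eq_mul]))
    (fun X₁ X₂ Y ↦ LinearMap.ext₂ fun U U' ↦ by
      simp only [LinearMap.mk₂_apply, LinearMap.add_apply, map_add])
    (fun c X Y ↦ LinearMap.ext₂ fun U U' ↦ by
      simp only [LinearMap.mk₂_apply, LinearMap.smul_apply, map_smul, smul_eq_mul])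
    (fun X Y₁ Y₂ ↦ LinearMap.ext₂ fun U U' ↦ by
      simp only [LinearMap.mk₂_apply, LinearMap.add_apply, map_add])
    (fun c X Y ↦ LinearMap.ext₂ fun U U' ↦ by
      simp only [LinearMap.mk₂_apply, LinearMap.smul_apply, map_smul, smul_eq_mul])

/-- **Third slot-arrangement of `∇²w`** (the divergence term of (7.5.14)):
`linRicciForm₃ g w x X Y` is the bilinear form `(U, U') ↦ (∇²w)(X, U', Y, U) = ∇_U ∇_Y w(X, U')`
on `T_x M`, whose metric trace is `g^{bd} ∇_b ∇_c γ_{ad} = ∇^b ∇_Y w(X, e_b)`; its symmetrisation in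
`(X, Y)` gives `g^{bd} ∇_b ∇_{(c} γ_{a)d}`. Wald 1984, (7.5.14), third term. [cite: Wald1984GR, §7.5, (7.5.14)] -/
def linRicciForm₃ (w : Π x : M, TangentSpace I x →L[ℝ] TangentSpace I x →L[ℝ] ℝ) (x : M) :
    TangentSpace I x →ₗ[ℝ] TangentSpace I x →ₗ[ℝ] LinearMap.BilinForm ℝ (TangentSpace I x) :=
  LinearMap.mk₂ ℝ
    (fun X Y ↦ LinearMap.mk₂ ℝ (fun U U' ↦ g.secondCovDeriv w x X U' Y U)
      (fun U₁ U₂ U' ↦ by simp only [map_add])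
      (fun c U U' ↦ by simp only [map_smul, smul_eq_mul])
      (fun U U'₁ U'₂ ↦ by simp only [map_add, LinearMap.add_apply])
      (fun c U U' ↦ by simp only [map_smul, LinearMap.smul_apply, smul_eq_mul]))
    (fun X₁ X₂ Y ↦ LinearMap.ext₂ fun U U' ↦ by
      simp only [LinearMap.mk₂_apply, LinearMap.add_apply, map_add])
    (fun c X Y ↦ LinearMap.ext₂ fun U U' ↦ by
      simp only [LinearMap.mk₂_apply, LinearMap.smul_apply, map_smul, smul_eq_mul])
    (fun X Y₁ Y₂ ↦ LinearMap.ext₂ fun U U' ↦ by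
      simp only [LinearMap.mk₂_apply, LinearMap.add_apply, map_add])
    (fun c X Y ↦ LinearMap.ext₂ fun U U' ↦ by
      simp only [LinearMap.mk₂_apply, LinearMap.smul_apply, map_smul, smul_eq_mul])

/-- `linRicciForm₁ g w x X Y U U' = (∇²w)(U, U', Y, X)`. [folklore] -/
@[simp]
theorem linRicciForm₁_apply (w : Π x : M, TangentSpace I x →L[ℝ] TangentSpace I x →L[ℝ] ℝ)
    (X Y U U' : TangentSpace I x) :
    g.linRicciForm₁ w x X Y U U' = g.secondCovDeriv w x U U' Y X :=
  rfl

/-- `linRicciForm₂ g w x X Y U U' = (∇²w)(X, Y, U', U)`. [folklore] -/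
@[simp]
theorem linRicciForm₂_apply (w : Π x : M, TangentSpace I x →L[ℝ] TangentSpace I x →L[ℝ] ℝ)
    (X Y U U' : TangentSpace I x) :
    g.linRicciForm₂ w x X Y U U' = g.secondCovDeriv w x X Y U' U :=
  rfl

/-- `linRicciForm₃ g w x X Y U U' = (∇²w)(X, U', Y, U)`. [folklore] -/
@[simp]
theorem linRicciForm₃_apply (w : Π x : M, TangentSpace I x →L[ℝ] TangentSpace I x →L[ℝ] ℝ)
    (X Y U U' : TangentSpace I x) :
    g.linRicciForm₃ w x X Y U U' = g.secondCovDeriv w x X U' Y U :=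
  rfl

variable [FiniteDimensional ℝ E]

omit [g.HasLeviCivita] in
/-- The metric trace is additive (copy of `trace_add`, `EinsteinProofs.lean`, outside this file's
import cone). [folklore] -/
private theorem trace_add_aux (S T : LinearMap.BilinForm ℝ (TangentSpace I x)) :
    g.trace x (S + T) = g.trace x S + g.trace x T := by
  simp only [trace, LinearMap.comp_add, map_add]

omit [g.HasLeviCivita] in
/-- The metric trace is homogeneous (copy of `trace_smul`, `EinsteinProofs.lean`). [folklore] -/
private theorem trace_smul_aux (c : ℝ) (T : LinearMap.BilinForm ℝ (TangentSpace I x)) :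
    g.trace x (c • T) = c * g.trace x T := by
  simp only [trace, LinearMap.comp_smul, map_smul, smul_eq_mul]

omit [g.HasLeviCivita] in
/-- The metric trace of the zero form vanishes (copy of `trace_zero`, `EinsteinProofs.lean`).
[folklore] -/
private theorem trace_zero_aux (x : M) :
    g.trace x (0 : LinearMap.BilinForm ℝ (TangentSpace I x)) = 0 := by
  simp [trace]

/-- **The linearised Ricci operator `DRic_g(w)_x = (d/dλ) Ric(g + λ w)|_{λ=0}`** of the metric `g`
acting on a field `w` of continuous bilinear forms (a metric perturbation `γ_{ab}`), as a bilinear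
form on `T_x M` — Wald 1984, (7.5.14)/(7.5.15), letter for letter:
`DRic(w)_{ac} = -½ g^{bd} ∇_a∇_c w_{bd} - ½ g^{bd} ∇_b∇_d w_{ac} + g^{bd} ∇_b ∇_{(c} w_{a)d}`
`           = -½ ∇_a∇_c (tr_g w) - ½ □_g w_{ac} + ∇^b ∇_{(c} w_{a)b}`,
realised with `Q = ∇²w = g.secondCovDeriv w x` (`Q(X,Y,Z,V) = ∇_V∇_Z w_{XY}`) and the metric
trace `tr = g.trace x` as
`DRic(w)(X,Y) = -½ tr[(U,U') ↦ Q(U,U',Y,X)] - ½ tr[(U,U') ↦ Q(X,Y,U',U)]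
               + ½ (tr[(U,U') ↦ Q(X,U',Y,U)] + tr[(U,U') ↦ Q(Y,U',X,U)])`
(the forms `linRicciForm₁/₂/₃`). Valid as the first variation of `Ric` on ANY background metric
and in any signature (the background Ricci tensor drops out of `Ṙ_{ac} = -2∇_{[a}Ċ^b{}_{b]c}`;
Besse 1987, Thm. 1.174 (d) with 1.179 is the same formula for a general pseudo-Riemannian metric),
for symmetric `C²` perturbations `w`; as an operator it is defined here on all fields `w`, with
the junk conventions of `covDeriv₂`/`covDeriv₃` where `w` is not twice differentiable. The
linearised vacuum Einstein equation about a Ricci-flat `g` is `DRic_g(w) = 0` ((7.5.15)); its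
pure-gauge solutions are `w = 𝓛_v g` ((C.2.15)–(C.2.17), `lieDerivBilin`).
[cite: Wald1984GR, §7.5, (7.5.14)–(7.5.15)] [cite: Besse1987, Thm. 1.174 (d) and 1.179] -/
def linearizedRicci (w : Π x : M, TangentSpace I x →L[ℝ] TangentSpace I x →L[ℝ] ℝ) (x : M) :
    LinearMap.BilinForm ℝ (TangentSpace I x) :=
  LinearMap.mk₂ ℝ
    (fun X Y ↦
      -(g.trace x (g.linRicciForm₁ w x X Y)) / 2 - g.trace x (g.linRicciForm₂ w x X Y) / 2 +
        (g.trace x (g.linRicciForm₃ w x X Y) + g.trace x (g.linRicciForm₃ w x Y X)) / 2)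
    (fun X₁ X₂ Y ↦ by
      simp only [map_add, LinearMap.add_apply, trace_add_aux]
      ring)
    (fun c X Y ↦ by
      simp only [map_smul, LinearMap.smul_apply, trace_smul_aux]
      ring)
    (fun X Y₁ Y₂ ↦ by
      simp only [map_add, LinearMap.add_apply, trace_add_aux]
      ring)
    (fun c X Y ↦ by
      simp only [map_smul, LinearMap.smul_apply, trace_smul_aux]
      ring)

/-- **`DRic` unfolded into the three traces of (7.5.14).**
`DRic(w)(X,Y) = -½ tr (linRicciForm₁ w X Y) - ½ tr (linRicciForm₂ w X Y)
  + ½ (tr (linRicciForm₃ w X Y) + tr (linRicciForm₃ w Y X))`. [cite: Wald1984GR, §7.5, (7.5.14)] -/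
theorem linearizedRicci_apply (w : Π x : M, TangentSpace I x →L[ℝ] TangentSpace I x →L[ℝ] ℝ)
    (X Y : TangentSpace I x) :
    g.linearizedRicci w x X Y =
      -(g.trace x (g.linRicciForm₁ w x X Y)) / 2 - g.trace x (g.linRicciForm₂ w x X Y) / 2 +
        (g.trace x (g.linRicciForm₃ w x X Y) + g.trace x (g.linRicciForm₃ w x Y X)) / 2 :=
  rfl

/-- **`DRic_g(0) = 0`**: the linearised Ricci operator annihilates the zero perturbation
(`∇²0 = 0`, `secondCovDeriv_zero`). [folklore] -/
@[simp]
theorem linearizedRicci_zero (x : M) :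
    g.linearizedRicci (0 : Π x : M, TangentSpace I x →L[ℝ] TangentSpace I x →L[ℝ] ℝ) x = 0 := by
  refine LinearMap.ext₂ fun X Y ↦ ?_
  have h₁ : ∀ X Y : TangentSpace I x, g.linRicciForm₁
      (0 : Π x : M, TangentSpace I x →L[ℝ] TangentSpace I x →L[ℝ] ℝ) x X Y = 0 := fun X Y ↦
    LinearMap.ext₂ fun U U' ↦ by simp
  have h₂ : ∀ X Y : TangentSpace I x, g.linRicciForm₂
      (0 : Π x : M, TangentSpace I x →L[ℝ] TangentSpace I x →L[ℝ] ℝ) x X Y = 0 := fun X Y ↦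
    LinearMap.ext₂ fun U U' ↦ by simp
  have h₃ : ∀ X Y : TangentSpace I x, g.linRicciForm₃
      (0 : Π x : M, TangentSpace I x →L[ℝ] TangentSpace I x →L[ℝ] ℝ) x X Y = 0 := fun X Y ↦
    LinearMap.ext₂ fun U U' ↦ by simp
  rw [linearizedRicci_apply, h₁, h₂, h₃, h₃, trace_zero_aux]
  simp

/-- **The linearised Ricci operator as a continuous bilinear form** on `T_x M` (`bilinFormCLM` of
`linearizedRicci`; finite dimension), so that `x ↦ DRic_g(w)_x` is again a field of the type of
`w` (it can be fed back into `lieDerivBilin`, `covDeriv₂`, `divergence`, or `linearizedRicci`).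
[cite: Wald1984GR, §7.5, (7.5.14)–(7.5.15)] -/
def linearizedRicciCLM (w : Π x : M, TangentSpace I x →L[ℝ] TangentSpace I x →L[ℝ] ℝ) (x : M) :
    TangentSpace I x →L[ℝ] TangentSpace I x →L[ℝ] ℝ :=
  bilinFormCLM x (g.linearizedRicci w x)

/-- `linearizedRicciCLM` is `linearizedRicci`. [folklore] -/
@[simp]
theorem linearizedRicciCLM_apply (w : Π x : M, TangentSpace I x →L[ℝ] TangentSpace I x →L[ℝ] ℝ)
    (X Y : TangentSpace I x) :
    g.linearizedRicciCLM w x X Y = g.linearizedRicci w x X Y :=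
  rfl

/-- `DRic_g(0) = 0`, continuous version. [folklore] -/
@[simp]
theorem linearizedRicciCLM_zero (x : M) :
    g.linearizedRicciCLM (0 : Π x : M, TangentSpace I x →L[ℝ] TangentSpace I x →L[ℝ] ℝ) x = 0 := by
  ext X Y
  simp

end LinearizedRicci

end PseudoRiemannianMetric

end Literature.Geometry.Lorentzian

end
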